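import Literature.MathematicalPhysics.QuantumFieldTheory.ConstructiveQFTWave0
import HarnessLib

/-!
# `RobustYangMillsRG` — negative side, part C₂: arithmetic of the crux's coarse anchors `cor`

Support lemmas for the disproof of the crux `RobustYangMillsRG` (stmt-QuantumFields-14958).
The crux anchors the block torus `(ℤ/M)^4` in the fine torus `(ℤ/N)^4` by
`cor y i = ⌊N·(y i)/M⌋` (`corVal N M v = N v / M`), with `M = N / b`, `b = ⌊ℓ₀/a_k⌋` the block
size. When `M b ≤ N` the anchor values `corVal v`, `v < M`, are pairwise at cyclic distance `≥ b`
and at most `N − b` (`corVal_add_le_of_lt`, `corVal_add_le`), so a fine site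
`anchor y o = cor y + o` with a small integer offset `o` (`|oᵢ| < b/2`) determines `(y, o)`
coordinatewise (`anchor_coord_inj`, `anchor_inj`); consecutive anchors in direction `i` are joined
by a straight path of length `pathLen y i ∈ [1, N/M + 1]` (`cor_shift`, `pathLen_pos`,
`pathLen_le`), whose interior sites are not anchors (`anchor_path_ne_cor`). These are the
book-keeping facts behind the wild blocking map of the disproof. [folklore]
-/

namespace Summit.QuantumFields.QCD.Theorems.RobustYangMillsRG.Negative

open Literature.MathematicalPhysics.QuantumFieldTheory

/-! ### The anchor values `⌊N v / M⌋` -/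

/-- The crux's anchor coordinate `corVal N M v = N v / M`. [folklore] -/
def corVal (N M v : ℕ) : ℕ := N * v / M

variable {N M b : ℕ}

/-- Monotonicity with gap: `corVal v + b (v' − v) ≤ corVal v'`-type bound — for `v < v'` and
`M b ≤ N`, `corVal v + b ≤ corVal v'`. [folklore] -/
theorem corVal_add_le_of_lt (hMb : M * b ≤ N) (hM : 0 < M) {v v' : ℕ} (hvv' : v < v') :
    corVal N M v + b ≤ corVal N M v' := by
  unfold corVal
  have h1 : b ≤ N * (v' - v) / M := by
    rw [Nat.le_div_iff_mul_le hM]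
    calc b * M = M * b := mul_comm _ _
      _ ≤ N := hMb
      _ ≤ N * (v' - v) := Nat.le_mul_of_pos_right _ (by omega)
  calc N * v / M + b ≤ N * v / M + N * (v' - v) / M := by omega
    _ ≤ (N * v + N * (v' - v)) / M := Nat.add_div_le_add_div _ _ _
    _ = N * v' / M := by rw [← Nat.mul_add]; congr 2; omega

/-- Upper bound: `corVal v + b ≤ N` for `v < M` and `M b ≤ N`. [folklore] -/
theorem corVal_add_le (hMb : M * b ≤ N) {v : ℕ} (hv : v < M) : corVal N M v + b ≤ N := by
  have hM : 0 < M := by omega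
  unfold corVal
  have h1 : b ≤ N * (M - v) / M := by
    rw [Nat.le_div_iff_mul_le hM]
    calc b * M = M * b := mul_comm _ _
      _ ≤ N := hMb
      _ ≤ N * (M - v) := Nat.le_mul_of_pos_right _ (by omega)
  calc N * v / M + b ≤ N * v / M + N * (M - v) / M := by omega
    _ ≤ (N * v + N * (M - v)) / M := Nat.add_div_le_add_div _ _ _
    _ = N * M / M := by rw [← Nat.mul_add]; congr 2; omega
    _ = N := Nat.mul_div_cancel _ hM

/-- `corVal` is monotone. [folklore] -/
theorem corVal_mono {v v' : ℕ} (h : v ≤ v') : corVal N M v ≤ corVal N M v' :=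
  Nat.div_le_div_right (Nat.mul_le_mul_left _ h)

/-- `corVal 0 = 0`. [folklore] -/
@[simp] theorem corVal_zero : corVal N M 0 = 0 := by simp [corVal]

/-- Consecutive anchors are at most `N / M + 1` apart. [folklore] -/
theorem corVal_succ_le (v : ℕ) : corVal N M (v + 1) ≤ corVal N M v + (N / M + 1) := by
  unfold corVal
  rcases Nat.eq_zero_or_pos M with rfl | hM
  · simp
  rw [Nat.mul_succ, Nat.add_div hM]
  split_ifs <;> omega

/-- The last anchor is at most `N / M + 1` below `N`. [folklore] -/
theorem sub_corVal_le (hM : 0 < M) : N - corVal N M (M - 1) ≤ N / M + 1 := by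
  unfold corVal
  have h1 : N * (M - 1) + N = N * M := by
    rw [← Nat.mul_add_one]; congr 1; omega
  have h2 : (N * (M - 1) + N) / M ≤ N * (M - 1) / M + N / M + 1 := by
    rw [Nat.add_div hM]; split_ifs <;> omega
  rw [h1, Nat.mul_div_cancel _ hM] at h2
  generalize N / M = q at h2 ⊢
  omega

/-- **Integer separation of anchors**: for `v ≠ v' < M`, the integer `corVal v' − corVal v` has
absolute value in `[b, N − b]`. [folklore] -/
theorem corVal_sub_bounds (hMb : M * b ≤ N) {v v' : ℕ} (hv : v < M) (hv' : v' < M) (hne : v ≠ v') :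
    (b : ℤ) ≤ |(corVal N M v' : ℤ) - corVal N M v| ∧
      |(corVal N M v' : ℤ) - corVal N M v| ≤ (N : ℤ) - b := by
  have hM : 0 < M := by omega
  rcases lt_or_gt_of_ne hne with hlt | hlt
  · have h1 := corVal_add_le_of_lt hMb hM hlt
    have h2 := corVal_add_le hMb hv'
    have h3 : (0 : ℤ) ≤ (corVal N M v' : ℤ) - corVal N M v := by
      have := corVal_mono (N := N) (M := M) hlt.le; omega
    rw [abs_of_nonneg h3]
    constructor <;> omega
  · have h1 := corVal_add_le_of_lt hMb hM hlt
    have h2 := corVal_add_le hMb hv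
    have h3 : (corVal N M v' : ℤ) - corVal N M v ≤ 0 := by
      have := corVal_mono (N := N) (M := M) hlt.le; omega
    rw [abs_of_nonpos h3]
    constructor <;> omega

/-! ### Anchored fine sites -/

variable [NeZero N] [NeZero M]

/-- The crux's coarse-to-fine anchor `cor y i = ⌊N (y i) / M⌋`. [folklore] -/
def cor (N : ℕ) (y : Site 4 M) : Site 4 N := fun i => ((corVal N M (y i).val : ℕ) : ZMod N)

/-- A fine site at integer offset `o` from the anchor of `y`: `cor y + o`. [folklore] -/
def anchor (N : ℕ) (y : Site 4 M) (o : Fin 4 → ℤ) : Site 4 N :=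
  fun i => (((corVal N M (y i).val : ℤ) + o i : ℤ) : ZMod N)

omit [NeZero N] [NeZero M] in
/-- `cor y = anchor y 0`. [folklore] -/
theorem cor_eq_anchor (y : Site 4 M) : cor N y = anchor N y 0 := by
  funext i; simp [cor, anchor]

omit [NeZero N] [NeZero M] in
/-- `anchor` is additive in the offset. [folklore] -/
theorem anchor_add (y : Site 4 M) (o o' : Fin 4 → ℤ) :
    anchor N y (o + o') = anchor N y o + fun i => ((o' i : ℤ) : ZMod N) := by
  funext i; simp [anchor]; ring

omit [NeZero N] [NeZero M] in
/-- Shifting an anchored site by a unit vector shifts the offset. [folklore] -/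
theorem anchor_shift (y : Site 4 M) (o : Fin 4 → ℤ) (k : Fin 4) :
    (anchor N y o).shift k = anchor N y (o + Pi.single k 1) := by
  funext i
  simp only [Site.shift, anchor, Pi.add_apply]
  by_cases hik : i = k
  · subst hik; simp; ring
  · simp [Pi.single_eq_of_ne hik]

omit [NeZero N] in
/-- **Coordinatewise injectivity of anchoring**: if `anchor y o = anchor y' o'` and in coordinate
`i` both offsets are `< b/2` in absolute value, then `y i = y' i` and `o i = o' i`
(needs `M b ≤ N`, `b ≤ N`... i.e. anchors are `b`-separated on a circle of length `≥ 2·(b/2)`). [folklore] -/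
theorem anchor_coord_inj (hMb : M * b ≤ N) {y y' : Site 4 M} {o o' : Fin 4 → ℤ}
    (h : anchor N y o = anchor N y' o') (i : Fin 4) (ho : 2 * |o i| < b) (ho' : 2 * |o' i| < b) :
    y i = y' i ∧ o i = o' i := by
  have hi := congrFun h i
  simp only [anchor] at hi
  rw [ZMod.intCast_eq_intCast_iff_dvd_sub] at hi
  -- `N ∣ (corVal v' + o' i) - (corVal v + o i)`
  have hv : (y i).val < M := ZMod.val_lt _
  have hv' : (y' i).val < M := ZMod.val_lt _
  have hbN : b ≤ N := le_trans (Nat.le_mul_of_pos_left b (by omega)) hMb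
  by_cases hvv : (y i).val = (y' i).val
  · have hy : y i = y' i := ZMod.val_injective _ hvv
    refine ⟨hy, ?_⟩
    rw [hvv] at hi
    have h2 : ((N : ℕ) : ℤ) ∣ o' i - o i := by simpa using hi
    have h3 : |o' i - o i| < (N : ℤ) := by
      calc |o' i - o i| ≤ |o' i| + |o i| := abs_sub _ _
        _ < N := by omega
    have := Int.eq_zero_of_abs_lt_dvd h2 h3
    omega
  · exfalso
    obtain ⟨h1, h2⟩ := corVal_sub_bounds hMb hv hv' hvv
    -- the integer `D + (o' i - o i)` is a nonzero multiple of `N` of absolute value `< N`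
    set D : ℤ := (corVal N M (y' i).val : ℤ) - corVal N M (y i).val with hD
    have h4 : ((N : ℕ) : ℤ) ∣ D + (o' i - o i) := by
      have : (corVal N M (y' i).val : ℤ) + o' i - ((corVal N M (y i).val : ℤ) + o i) = D + (o' i - o i) := by
        rw [hD]; ring
      rw [← this]; exact hi
    have h5 : |D + (o' i - o i)| < (N : ℤ) := by
      calc |D + (o' i - o i)| ≤ |D| + |o' i - o i| := abs_add_le _ _
        _ ≤ |D| + (|o' i| + |o i|) := by gcongr; exact abs_sub _ _
        _ < N := by omega
    have h6 := Int.eq_zero_of_abs_lt_dvd h4 h5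
    have h7 : |D| = |o' i - o i| := by
      have : D = -(o' i - o i) := by omega
      rw [this, abs_neg]
    have h8 : |o' i - o i| < b := by
      calc |o' i - o i| ≤ |o' i| + |o i| := abs_sub _ _
        _ < b := by omega
    omega

omit [NeZero N] in
/-- Full injectivity of anchoring for small offsets. [folklore] -/
theorem anchor_inj (hMb : M * b ≤ N) {y y' : Site 4 M} {o o' : Fin 4 → ℤ}
    (h : anchor N y o = anchor N y' o') (ho : ∀ i, 2 * |o i| < b) (ho' : ∀ i, 2 * |o' i| < b) :
    y = y' ∧ o = o' :=
  ⟨funext fun i => (anchor_coord_inj hMb h i (ho i) (ho' i)).1,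
    funext fun i => (anchor_coord_inj hMb h i (ho i) (ho' i)).2⟩

/-! ### Straight paths between consecutive anchors -/

/-- The length of the straight fine path from `cor y` to `cor (y + eᵢ)`. [folklore] -/
def pathLen (N : ℕ) (y : Site 4 M) (i : Fin 4) : ℕ :=
  if (y i).val + 1 < M then corVal N M ((y i).val + 1) - corVal N M (y i).val
  else N - corVal N M (y i).val

/-- The value of the shifted coordinate. [folklore] -/
theorem val_shift_self (y : Site 4 M) (i : Fin 4) :
    ((y.shift i) i).val = if (y i).val + 1 < M then (y i).val + 1 else 0 := by
  have hv : (y i).val < M := ZMod.val_lt _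
  simp only [Site.shift, Pi.add_apply, Pi.single_eq_same]
  split_ifs with h
  · rw [ZMod.val_add, ZMod.val_one'', Nat.mod_eq_of_lt h]
    omega
  · have hM : (y i).val + 1 = M := by omega
    rw [ZMod.val_eq_zero]
    have : ((((y i).val + 1 : ℕ)) : ZMod M) = 0 := by rw [hM, ZMod.natCast_self]
    have h2 : (y i) + 1 = (((y i).val + 1 : ℕ) : ZMod M) := by
      push_cast; rw [ZMod.natCast_zmod_val]
    rw [h2, this]

omit [NeZero M] in
/-- The shift does not change the other coordinates. [folklore] -/
theorem shift_apply_of_ne (y : Site 4 M) {i c : Fin 4} (h : c ≠ i) : (y.shift i) c = y c := by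
  simp [Site.shift, Pi.single_eq_of_ne h]

omit [NeZero N] in
/-- **Consecutive anchors**: `cor (y + eᵢ) = cor y + pathLen y i · eᵢ`. [folklore] -/
theorem cor_shift (y : Site 4 M) (i : Fin 4) :
    cor N (y.shift i) = anchor N y (Pi.single i (pathLen N y i : ℤ)) := by
  funext c
  by_cases hc : c = i
  · subst hc
    simp only [cor, anchor, Pi.single_eq_same, val_shift_self, pathLen]
    have hv : (y c).val < M := ZMod.val_lt _
    split_ifs with h
    · have hmono := corVal_mono (N := N) (M := M) (Nat.le_succ (y c).val)
      rw [Nat.cast_sub hmono]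
      push_cast
      ring
    · have hle : corVal N M (y c).val ≤ N := by
        unfold corVal
        calc N * (y c).val / M ≤ N * M / M := Nat.div_le_div_right (Nat.mul_le_mul_left _ hv.le)
          _ ≤ N := Nat.div_le_of_le_mul (by rw [mul_comm])
      rw [corVal_zero]
      push_cast [Nat.cast_sub hle]
      simp
  · simp only [cor, anchor, shift_apply_of_ne y hc, Pi.single_eq_of_ne hc]
    push_cast
    ring

omit [NeZero N] in
/-- The path has positive length (`M b ≤ N`, `1 ≤ b`). [folklore] -/
theorem pathLen_pos (hMb : M * b ≤ N) (hb : 1 ≤ b) (y : Site 4 M) (i : Fin 4) :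
    1 ≤ pathLen N y i := by
  have hv : (y i).val < M := ZMod.val_lt _
  have hM : 0 < M := by omega
  unfold pathLen
  split_ifs with h
  · have := corVal_add_le_of_lt (N := N) hMb hM (Nat.lt_add_one (y i).val)
    omega
  · have := corVal_add_le (N := N) hMb hv
    omega

omit [NeZero N] in
/-- The path is at least `b` long. [folklore] -/
theorem le_pathLen (hMb : M * b ≤ N) (y : Site 4 M) (i : Fin 4) : b ≤ pathLen N y i := by
  have hv : (y i).val < M := ZMod.val_lt _
  have hM : 0 < M := by omega
  unfold pathLen
  split_ifs with h
  · have := corVal_add_le_of_lt (N := N) hMb hM (Nat.lt_add_one (y i).val)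
    omega
  · have := corVal_add_le (N := N) hMb hv
    omega

omit [NeZero N] in
/-- The path is at most `N / M + 1` long. [folklore] -/
theorem pathLen_le (y : Site 4 M) (i : Fin 4) : pathLen N y i ≤ N / M + 1 := by
  have hv : (y i).val < M := ZMod.val_lt _
  have hM : 0 < M := by omega
  unfold pathLen
  split_ifs with h
  · have := corVal_succ_le (N := N) (M := M) (y i).val
    generalize N / M = q at this ⊢
    omega
  · have hv' : (y i).val = M - 1 := by omega
    rw [hv']
    exact sub_corVal_le hM

omit [NeZero N] [NeZero M] in
/-- `N / M ≤ 2 b` when `M = N / b ≥ 1`. [folklore] -/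
theorem div_le_two_mul (hM : M = N / b) (hbN : b ≤ N) (hb : 1 ≤ b) : N / M ≤ 2 * b := by
  have hq : 1 ≤ N / b := (Nat.le_div_iff_mul_le hb).2 (by simpa using hbN)
  rw [hM]
  apply Nat.div_le_of_le_mul
  have h1 : N < (N / b + 1) * b := Nat.lt_mul_of_div_lt (Nat.lt_succ_self _) hb
  nlinarith

/-- **Interior path sites are not anchors**: for `0 < t < pathLen y i` the `i`-th coordinate of
`cor y + t eᵢ` is no anchor value, so the site is not `cor y'` for any `y'`. [folklore] -/
theorem anchor_path_ne_cor (hMb : M * b ≤ N) (y y' : Site 4 M) (i : Fin 4) {t : ℕ} (ht0 : 0 < t)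
    (ht : t < pathLen N y i) : anchor N y (Pi.single i (t : ℤ)) ≠ cor N y' := by
  intro h
  have hi := congrFun h i
  simp only [anchor, cor, Pi.single_eq_same] at hi
  have hv : (y i).val < M := ZMod.val_lt _
  have hv' : (y' i).val < M := ZMod.val_lt _
  have hM : 0 < M := by omega
  -- both sides are naturals `< N`; compare as naturals
  have hlt : corVal N M (y i).val + t < N := by
    unfold pathLen at ht
    split_ifs at ht with h1
    · have := corVal_add_le (N := N) hMb h1; omega
    · omega
  have hlt' : corVal N M (y' i).val < N := by
    have := corVal_add_le (N := N) hMb hv'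
    have hb : 1 ≤ b ∨ b = 0 := by omega
    rcases hb with hb | rfl
    · omega
    · -- degenerate `b = 0`: still `corVal v' < N` unless `N = 0`
      have hN : 0 < N := Nat.pos_of_ne_zero (NeZero.ne N)
      unfold corVal
      calc N * (y' i).val / M < N * M / M := by
            apply Nat.div_lt_div_of_lt_of_dvd (Nat.dvd_mul_left M N)
            exact Nat.mul_lt_mul_of_pos_left hv' hN
        _ = N := Nat.mul_div_cancel _ hM
  have heq : corVal N M (y i).val + t = corVal N M (y' i).val := by
    have h2 : (((corVal N M (y i).val + t : ℕ) : ℤ) : ZMod N) = (((corVal N M (y' i).val : ℕ) : ℤ) : ZMod N) := by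
      push_cast at hi ⊢; exact hi
    rw [Int.cast_natCast, Int.cast_natCast] at h2
    have := (ZMod.natCast_eq_natCast_iff' _ _ _).1 h2
    rwa [Nat.mod_eq_of_lt hlt, Nat.mod_eq_of_lt hlt'] at this
  -- now compare with monotonicity
  rcases lt_trichotomy (y' i).val (y i).val with hlt2 | heq2 | hgt2
  · have := corVal_mono (N := N) (M := M) hlt2.le; omega
  · rw [heq2] at heq; omega
  · -- `v + 1 ≤ v'`: `corVal (v+1) ≤ corVal v'`, but `corVal v + t < corVal (v+1)`
    unfold pathLen at ht
    split_ifs at ht with h1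
    · have := corVal_mono (N := N) (M := M) (show (y i).val + 1 ≤ (y' i).val by omega)
      omega
    · omega

end Summit.QuantumFields.QCD.Theorems.RobustYangMillsRG.Negative
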